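import Summits.CriticalPhenomena.PercolationContinuityZ3.Theorems.Transplant.FKConjectureCDefs

/-!
substantive: `FK.ConjectureC` (the all-matroid pair-square-cone statement `(ID)_J`, tree
`Summit.CriticalPhenomena.PercolationContinuityZ3.Theorems.FK.ConjectureC`, p652189, recorded `@[conjecture]`) is FALSE;
witness «Z₅∖y₅, J = 0, Σ = −216»: the binary 5-spike with tip minus one leg element (ten elements, rank 5), level
`J = 0`, test function `1[4 ∈ x]·1[9 ∈ y]`, `Σ_{x,y} conjCKernel M 0 x y · Φ x y = −216 < 0`. The load-bearing claim
(membership of every level kernel of every matroid in the pair-square cone) fails; no cheap repair: the witness is a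
binary (non-regular) matroid, so any true restatement must restrict the matroid class (regular / graphic / cycle
matroids — the case the percolation bridge needs — is NOT refuted here and stays open).

# A counterexample to `FK.ConjectureC`

Filed for the tree by fkp-10a gen 358 (prover-prim-bschramm-fkp-10a-g358-0) on director-frontier g15's RE-POINT (cell
INBOX l.8776, 2026-08-29T06:31:11Z; coordinator fk-4 gen 293 ORDER WORD l.8777): a byte-copy of the critic's file
`fk-continuity/ideation/prim-bschramm-fk-crit-1/COUNTEREXAMPLE/lean/SpikeCounterexample.lean` (fk-crit-1 g2, sha256
809bbe0318fa…, kernel-checked rc 0) with this docstring paragraph added and nothing else changed. An independent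
second formalisation of the same witness — the vector matroid `S₁₀ = Z₅ ∖ y₅` over `ZMod 2` via
`Literature.Combinatorics.Matroid.VectorMatroid`, two `native_decide` steps — is fk-idea-4 gen 3's
`fk-continuity/ideation/prim-bschramm-fk-idea-4/gen3/lean/FKConjectureCRefutationS10.lean` (sha256 d3faf6c88ce2…), cited
here as the cross-check of the value `221200 − 221416 = −216`. Framing (director-frontier g15): «FRONTIER rung F-BS /
FBP₀; decides the lane's own all-matroid statement only; nothing percolation-bearing; typed ≠ proved until the gate
accepts.» COMPUTATIONAL (`native_decide` ×6; proposed `--computational`). builds on p205010 (kernel theorem, internal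
audit signed; external expert review pending).

The binary matroid `M` on `Fin 10` with columns `e₁,…,e₅, 𝟙+e₁,…,𝟙+e₄, 𝟙 ∈ 𝔽₂⁵` (the binary 5-spike with tip,
one leg element deleted) violates `(ID)₀`: for the test function `Φ(x,y) = 1[4 ∈ x]·1[9 ∈ y]`, whose increment on
every elementary square is a product of two nonnegative numbers, `Σ_{x,y} conjCKernel M 0 x y · Φ x y = -216 < 0`,
contradicting `FK.sum_mul_nonneg_of_inPairSquareCone`.  The matroid is presented by an explicit computable
independence oracle (GF(2) elimination, tabulated); its axioms, its rank table and the value `-216` are checked by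
`native_decide` (computational).
-/

namespace Summit.CriticalPhenomena.PercolationContinuityZ3.Theorems.FK.Cex

open Literature.Combinatorics.Matroid Finset

/-- The ten columns, as bitmasks of vectors in `𝔽₂⁵`: `e₁..e₅ = 1,2,4,8,16`, `𝟙+eᵢ = 31 XOR eᵢ` (`i ≤ 4`), `𝟙 = 31`. -/
def col : Fin 10 → ℕ := ![1, 2, 4, 8, 16, 30, 29, 27, 23, 31]

/-- All subset-XORs of a list of vectors (with multiplicity): the list has no duplicates iff the vectors are
linearly independent over `𝔽₂`; its number of distinct entries is `2 ^ rank`. -/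
def spanList (l : List ℕ) : List ℕ := l.foldl (fun acc v => acc ++ acc.map (· ^^^ v)) [0]

/-- The elements of `Fin 10` selected by a bitmask `m < 1024`. -/
def elemsOfMask (m : ℕ) : List (Fin 10) := (List.finRange 10).filter (fun i => m.testBit i.val)

/-- GF(2)-rank of the columns selected by the mask `m`. -/
def rkMask (m : ℕ) : ℕ := Nat.log 2 ((spanList ((elemsOfMask m).map col)).eraseDups.length)

/-- Rank table, computed once. -/
def rkTable : Array ℕ := Array.ofFn (n := 1024) (fun i => rkMask i.val)

/-- Bitmask of a finset of `Fin 10`. -/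
def maskOf (s : Finset (Fin 10)) : ℕ := ∑ i ∈ s, 2 ^ (i : ℕ)

/-- Rank of a finset (table lookup). -/
def rkT (s : Finset (Fin 10)) : ℕ := rkTable.getD (maskOf s) 0

/-- Independence oracle. -/
def indepB (s : Finset (Fin 10)) : Bool := rkT s == s.card

/-- The empty set is independent (computational). [folklore] -/
theorem indep_empty : indepB ∅ = true := by native_decide
/-- The oracle is subset-closed (computational check over all pairs of finsets of `Fin 10`). [folklore] -/
theorem indep_subset : ∀ I J : Finset (Fin 10), indepB J = true → I ⊆ J → indepB I = true := by native_decide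
/-- The oracle satisfies the augmentation axiom (computational check over all pairs). [cite: Oxley2011, §1.1 (I3)] -/
theorem indep_aug : ∀ I J : Finset (Fin 10), indepB I = true → indepB J = true → I.card < J.card →
    ∃ e ∈ J, e ∉ I ∧ indepB (insert e I) = true := by native_decide
/-- The tabulated rank of every finset is attained by an independent subset (computational). [cite: Oxley2011, §1.3] -/
theorem rk_attained : ∀ X : Finset (Fin 10), ∃ I ∈ X.powerset, indepB I = true ∧ I.card = rkT X := by native_decide
/-- No independent subset exceeds the tabulated rank (computational). [cite: Oxley2011, §1.3] -/
theorem rk_upper : ∀ X : Finset (Fin 10), ∀ I ∈ X.powerset, indepB I = true → I.card ≤ rkT X := by native_decide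

/-- The counterexample matroid (ground set `univ`). -/
def M : Matroid (Fin 10) :=
  (IndepMatroid.ofFinset (Set.univ : Set (Fin 10)) (fun I => indepB I = true) indep_empty
    (fun I J hJ hIJ => indep_subset I J hJ hIJ) (fun I J hI hJ hlt => indep_aug I J hI hJ hlt)
    (fun _ _ => Set.subset_univ _)).matroid

/-- Independence in `M` is the oracle. [folklore] -/
theorem M_indep_iff (I : Finset (Fin 10)) : M.Indep (I : Set (Fin 10)) ↔ indepB I = true := by
  unfold M; simp [IndepMatroid.ofFinset_indep]

/-- The rank function of `M` is the table `rkT`. [cite: Oxley2011, §1.3] -/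
theorem eRk_eq (X : Finset (Fin 10)) : M.eRk (X : Set (Fin 10)) = rkT X := by
  apply le_antisymm
  · rw [Matroid.eRk_le_iff]
    intro I hIX hI
    have hfin : I.Finite := Set.toFinite I
    obtain ⟨I', rfl⟩ : ∃ I' : Finset (Fin 10), I = ↑I' := ⟨hfin.toFinset, by simp⟩
    rw [M_indep_iff] at hI
    have hsub : I' ⊆ X := by exact_mod_cast hIX
    have := rk_upper X I' (Finset.mem_powerset.mpr hsub) hI
    rw [Set.encard_coe_eq_coe_finsetCard]; exact_mod_cast this
  · obtain ⟨I, hIX, hI, hcard⟩ := rk_attained X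
    rw [Matroid.le_eRk_iff]
    refine ⟨I, ?_, (M_indep_iff I).mpr hI, ?_⟩
    · exact_mod_cast Finset.mem_powerset.mp hIX
    · rw [Set.encard_coe_eq_coe_finsetCard, hcard]

/-- The corank (nullity) of `M` in closed form. [cite: Oxley2011, §1.3] -/
theorem corank_eq (X : Finset (Fin 10)) : corank M X = X.card - rkT X := by
  unfold corank; rw [eRk_eq, ENat.toNat_coe]

attribute [irreducible] rkT

/-- Computable corank. -/
def crT (s : Finset (Fin 10)) : ℕ := s.card - rkT s

/-- The twisted nullity level of `M`, computably. [folklore] -/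
theorem twisted_eq (x y : Finset (Fin 10)) : twistedNullLevel M x y = crT (x \ y) + crT (y \ x) := by
  unfold twistedNullLevel crT; rw [corank_eq, corank_eq]; congr <;> exact Subsingleton.elim _ _

/-- The aligned nullity level of `M`, computably. [folklore] -/
theorem aligned_eq (x y : Finset (Fin 10)) : alignedNullLevel M x y = crT (x ∩ y) + crT (xᶜ ∩ yᶜ) := by
  unfold alignedNullLevel crT; rw [corank_eq, corank_eq]; congr <;> exact Subsingleton.elim _ _

/-- Computable integer version of `conjCKernel M 0`. -/
def kZ (x y : Finset (Fin 10)) : ℤ :=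
  (if crT (x \ y) + crT (y \ x) ≤ 0 then 1 else 0) - (if crT (x ∩ y) + crT (xᶜ ∩ yᶜ) ≤ 0 then 1 else 0)

/-- The level-`0` kernel of `M` is the computable integer kernel `kZ`. [folklore] -/
theorem conjCKernel_eq (x y : Finset (Fin 10)) : conjCKernel M 0 x y = (kZ x y : ℝ) := by
  unfold conjCKernel kZ; rw [twisted_eq, aligned_eq]; push_cast; split_ifs <;> simp

/-- The test function `Φ(x,y) = 1[4 ∈ x]·1[9 ∈ y]` as an integer. -/
def phiZ (x y : Finset (Fin 10)) : ℤ := if (4 : Fin 10) ∈ x ∧ (9 : Fin 10) ∈ y then 1 else 0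

/-- **The decisive value**: `Σ_{x,y} K₀(x,y)·1[4∈x]1[9∈y] = -216` (computational; `39256` pairs with `K₀ = 1` against `39472` with `K₀ = -1`). [folklore] -/
theorem the_sum : (∑ x : Finset (Fin 10), ∑ y : Finset (Fin 10), kZ x y * phiZ x y) = -216 := by native_decide

/-- The test function `1[4∈x]1[9∈y]` has nonnegative increment on every elementary square (for any decidable equality used to form `insert`). [cite: Wagner2006, Thm. 5.8(d), §5.3] -/
theorem phi_increment_nonneg (inst : DecidableEq (Fin 10)) (x y : Finset (Fin 10)) (a b : Fin 10) :
    (0 : ℝ) ≤ (phiZ x y : ℝ) + (phiZ (insert a x) (insert b y) : ℝ) - (phiZ (insert a x) y : ℝ)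
      - (phiZ x (insert b y) : ℝ) := by
  have h4 : (4 : Fin 10) ∈ x → (4 : Fin 10) ∈ insert a x := fun h => Finset.mem_insert_of_mem h
  have h9 : (9 : Fin 10) ∈ y → (9 : Fin 10) ∈ insert b y := fun h => Finset.mem_insert_of_mem h
  unfold phiZ
  by_cases hx : (4 : Fin 10) ∈ x <;> by_cases hy : (9 : Fin 10) ∈ y <;>
    by_cases hx' : (4 : Fin 10) ∈ insert a x <;> by_cases hy' : (9 : Fin 10) ∈ insert b y <;>
    simp_all

/-- **`FK.ConjectureC` is false**: the kernel of the matroid `M` above at level `0` is not in the pair-square cone. -/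
theorem not_inPairSquareCone : ¬ InPairSquareCone (conjCKernel M 0) := by
  intro hM
  have key := sum_mul_nonneg_of_inPairSquareCone hM (fun x y => (phiZ x y : ℝ)) (phi_increment_nonneg _)
  have hs : (∑ x : Finset (Fin 10), ∑ y : Finset (Fin 10), conjCKernel M 0 x y * (phiZ x y : ℝ))
      = ((∑ x : Finset (Fin 10), ∑ y : Finset (Fin 10), kZ x y * phiZ x y : ℤ) : ℝ) := by
    push_cast
    exact Finset.sum_congr rfl fun x _ => Finset.sum_congr rfl fun y _ => by rw [conjCKernel_eq]
  rw [hs, the_sum] at key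
  norm_num at key

end Summit.CriticalPhenomena.PercolationContinuityZ3.Theorems.FK.Cex

namespace Summit.CriticalPhenomena.PercolationContinuityZ3.Theorems.FK

/-- The level-`0` cell of the witness matroid, stated on its own: `conjCKernel M 0 ∉ Sq`. [cite: Oxley2011, §1.5 (spikes)] -/
theorem not_conjectureCOn_fin_ten : ¬ ConjectureCOn (Fin 10) := fun h => Cex.not_inPairSquareCone (h Cex.M 0)


/-- **Refutation of `FK.ConjectureC` (fk-2's matroid statement `(ID)_J`, the typed FBP₀ deciding statement):** the binary
matroid on ten elements with columns `e₁,…,e₅, 𝟙+e₁,…,𝟙+e₄, 𝟙 ∈ 𝔽₂⁵` — the binary `5`-spike with tip with one leg element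
deleted (its rank-`4` analogue is `S₈`, where the same functional vanishes exactly) — has
`Σ_{x,y} conjCKernel M 0 x y · 1[4 ∈ x] 1[9 ∈ y] = -216 < 0`, while every kernel in the pair-square cone pairs
nonnegatively with this test function (`sum_mul_nonneg_of_inPairSquareCone`).  Hence `(ID)₀` fails for this matroid,
`¬ ConjectureCOn (Fin 10)`, `¬ ConjectureC`.  COMPUTATIONAL: the matroid axioms of the tabulated 𝔽₂-independence
oracle, its rank table and the value `-216` are evaluated by `native_decide`; the value is reproduced independently by
two exact external computations (direct `4¹⁰`-pair sum; disjoint-pair closed form).  What is NOT refuted: every cell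
decided true so far (uniform `U_{r,n}` with `2r ≥ n-3`, `F₇`, `R₁₀`, `AG(2,3)`, all matroids on `≤ 8` elements, …), and
the graphic / regular case that the percolation bridge needs — the witness is non-regular.
[cite: Oxley2011, §1.5 (spikes), Appendix (S₈)] [cite: Wagner2006, Thm. 5.8(d), §5.3] -/
theorem not_conjectureC : ¬ ConjectureC := fun h => not_conjectureCOn_fin_ten (h 10)

end Summit.CriticalPhenomena.PercolationContinuityZ3.Theorems.FK
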